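import Literature.NumberTheory.Automorphic.SLTwoTreeProjectiveAction              -- ★ B-p08 (g28) (W1c)-A part 1: `glVertexAct`, `glVertexAct_eq_iff`, `_one`, `_mul`
import Literature.NumberTheory.Automorphic.HermitianLatticeTreeFlagTransitive     -- ★ B-p04 (g35): `forall_flag_exists_latt_eq_of_rootStar`, `exists_eq_latt_mul_diagonal_of_isModularLattice`
import HarnessLib

/-!
# `SL₂(F)` is transitive on the vertices of each type and on the flags of its tree; `GL₂(F)` is transitive on vertices and on darts, with prescribed
# determinant (Serre, *Trees*, Ch. II §1.1–§1.4)

Topic `NumberTheory/Automorphic`; namespace `Literature.NumberTheory.Automorphic.HermitianLatticeTree`.  THEOREMS ONLY (no definition, no instance, no notation, no named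
fact, no `sorry`); kernel lane.  Cell `pub/hodgecm-mathlib` (D-0151), crux H413 = `stmt-HodgeConjecture-24833`, line «N6nsGerm», residue «R2EP-wild» of
`stub_N6nsR2EP : RankOneEulerPoincareNonsplit`, ROAD W brick (W1c)-A part 4 (census `B-provers/B-p08/g28/CENSUS-W1c-W2-TreeAction.B-p08g28.md`): the binders `hV`
(one vertex orbit) and `hD` (one dart orbit) of B-p14 (g32)'s (W3)+(W4)-generic head `TreeAction.natCard_fixedBy_add_eq_natCard_fixedBy_add_one_of_treeAction` are
instantiated at `U(Φ₂)(E_w)` ((W1c)-B) from the present `GL₂(F_v)`-level statements WITH PRESCRIBED DETERMINANT (`det g = 1`, or `det g = c` for any `c` with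
`|c| = |ϖ|` — at a ramified place `c = N(ϖ_E)` is a norm, which is what puts `[g]` in the image of `U`).  HONEST LABEL: HC_CM is proved only modulo the cell's 2
remaining named inputs (hLiu418, h413) until rung 0 closes; nothing printed is asserted here — elementary lattice algebra over a DVR.

THE MATHEMATICS (`X = latticeTree (RingHom.id F) ϖ J`, `J = (0 1; −1 0)`, `U(id, J) = SL₂(F)` ★ `mem_unitaryGroupOfForm_id_altJ_iff`; root `v₀ = latt 1 = 𝒪²`, reference
neighbour `v₁ = latt diag(1, ϖ) = 𝒪 ⊕ ϖ𝒪`).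
* §1 The SELF-DUAL LOCUS of `(id, J)` is `SL₂(F)·GL₂(𝒪)` (`|det h| = 1 ⇒ h = (h·diag(1, det h)⁻¹)·diag(1, det h)`): `selfDualLocus_id_altJ`; hence ★ F0P2-p02's (hA)∕(hB)
  `forall_isSelfDualLattice_exists_latt_eq_id_altJ`, `forall_isModularLattice_exists_latt_mul_eq_id_altJ` (`SL₂(F)` transitive on each type), the ROOT STAR
  `forall_isModularLattice_rootStar_exists_latt_mul_eq_id_altJ` (`SL₂(𝒪)` transitive on the `q + 1` neighbours `latt (P·diag(1,ϖ))`, `P ∈ GL₂(𝒪)`, of the root — ★ B-p04's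
  root-star normal form, the isotropy condition being vacuous for an alternating form), and ★ B-p04's (hI) `forall_flag_exists_latt_eq_id_altJ` (`SL₂(F)` transitive on flags).
* §2 In `glVertexAct` currency, for `v₀ v₁` given by binders `hv₀ : v₀ = latt 1`, `hv₁ : v₁ = latt diag(1, ϖ)`: `latticeTree_adj_root` (`v₀ ∼ v₁`);
  **`exists_det_eq_one_and_glVertexAct_eq`** (self-dual `N = g·v₀`, `det g = 1`); **`exists_det_eq_and_glVertexAct_eq`** (modular `N = g·v₀`, `det g = c`, any `|c| = |ϖ|`);
  **`exists_det_eq_one_and_glVertexAct_eq_of_adj`** (dart `(a, b)` with `a` self-dual `= g·(v₀, v₁)`, `det g = 1`); the SWAP `exists_det_eq_and_glVertexAct_swap`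
  (`w = (0 −1; c 0)`: `w·v₀ = v₁`, `w·v₁ = v₀`, `det w = c` — an inversion of the edge `{v₀, v₁}`); **`exists_det_eq_and_glVertexAct_eq_of_adj`** (dart with `a` modular,
  `det g = c`); corollaries `exists_glVertexAct_eq` (ONE VERTEX ORBIT of `GL₂(F)`) and `exists_glVertexAct_eq_of_adj` (ONE DART ORBIT).

## References
* [Serre1980Trees] J.-P. Serre, *Trees* (1980), Ch. II §1.1 Theorem 1, §1.2–§1.4 (`SL₂` has two vertex orbits and is transitive on edges from each; `GL₂` is
  transitive with inversions).
* [Kottwitz1988] R. E. Kottwitz, *Tamagawa numbers*, Ann. of Math. 127 (1988), §2.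
* [BruhatTits1972] F. Bruhat, J. Tits, *Groupes réductifs sur un corps local I*, Publ. IHÉS 41 (1972), §10.
-/

set_option autoImplicit false

noncomputable section

open scoped ValuativeRel Matrix MatrixGroups
open Matrix ValuativeRel

namespace Literature.NumberTheory.Automorphic.HermitianLatticeTree

open Literature.NumberTheory.Automorphic Literature.NumberTheory.Automorphic.UnitaryGroup

variable {F : Type*} [Field F] [ValuativeRel F] {ϖ : F} (hϖ : IsUniformizingElement ϖ) [IsDiscreteValuationRing 𝒪[F]]

/-! ## §0 Two integral diagonal matrices -/

omit [IsDiscreteValuationRing 𝒪[F]] in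
/-- `diag(1, u) ∈ GL₂(𝒪)` for a unit `u` (as an element of `GL₂(F)` with the stated matrix and determinant). [cite: Serre1980Trees, Ch. II §1.1] -/
theorem exists_mem_glInt_coe_eq_diagonal {u : F} (hu : valuation F u = 1) :
    ∃ D : GL (Fin 2) F, (D : Matrix (Fin 2) (Fin 2) F) = Matrix.diagonal ![1, u] ∧ D ∈ glInt 2 F ∧ (D : Matrix (Fin 2) (Fin 2) F).det = u := by
  have hu0 : u ≠ 0 := fun h => by rw [h, map_zero] at hu; exact zero_ne_one hu
  have hdet : (Matrix.diagonal ![(1 : F), u]).det = u := by rw [det_diagonal, Fin.prod_univ_two]; simp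
  refine ⟨Matrix.GeneralLinearGroup.mk'' _ (isUnit_iff_ne_zero.2 (hdet.symm ▸ hu0 : (Matrix.diagonal ![(1 : F), u]).det ≠ 0)), rfl,
    mem_glInt_of_isIntegralMatrix (fun i j => ?_) ?_, hdet⟩
  · show Matrix.diagonal ![(1 : F), u] i j ∈ 𝒪[F]
    fin_cases i <;> fin_cases j <;> simp [Valuation.mem_integer_iff, hu.le]
  · show valuation F (Matrix.diagonal ![(1 : F), u]).det = 1
    rw [hdet, hu]

omit [ValuativeRel F] [IsDiscreteValuationRing 𝒪[F]] in
/-- The reference neighbour's matrix `diag(1, ϖ)` as an element of `GL₂(F)` (`ϖ ≠ 0`), of determinant `ϖ`. [cite: Serre1980Trees, Ch. II §1.1] -/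
theorem exists_coe_eq_diagonal_one_uniformizer (h0 : ϖ ≠ 0) :
    ∃ g₁ : GL (Fin 2) F, (g₁ : Matrix (Fin 2) (Fin 2) F) = Matrix.diagonal ![1, ϖ] ∧ (g₁ : Matrix (Fin 2) (Fin 2) F).det = ϖ := by
  have hdet : (Matrix.diagonal ![(1 : F), ϖ]).det = ϖ := by rw [det_diagonal, Fin.prod_univ_two]; simp
  exact ⟨Matrix.GeneralLinearGroup.mk'' _ (isUnit_iff_ne_zero.2 (hdet.symm ▸ h0 : (Matrix.diagonal ![(1 : F), ϖ]).det ≠ 0)), rfl, hdet⟩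

omit [IsDiscreteValuationRing 𝒪[F]] in
/-- `g · 𝒪² = latt g` (`mapGL g (latt 1) = latt ↑g`). [cite: Serre1980Trees, Ch. II §1.1] -/
theorem mapGL_latt_one (g : GL (Fin 2) F) : mapGL g (latt (1 : Matrix (Fin 2) (Fin 2) F)) = latt (g : Matrix (Fin 2) (Fin 2) F) := by
  have h := mapGL_latt g 1
  rwa [mul_one, Units.val_one] at h

omit [IsDiscreteValuationRing 𝒪[F]] in
/-- `latt diag(1, ϖ)` in the frame spelling `latt (↑1 · diag(ϖ⁰, ϖ¹))` of ★ `HermitianLatticeTreeDiagonal`. [cite: Serre1980Trees, Ch. II §1.1] -/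
theorem latt_diagonal_one_uniformizer_eq :
    latt (Matrix.diagonal ![(1 : F), ϖ]) = latt (((1 : GL (Fin 2) F) : Matrix (Fin 2) (Fin 2) F) * Matrix.diagonal ![ϖ ^ (0 : ℤ), ϖ ^ (1 : ℤ)]) := by
  rw [Units.val_one, one_mul]
  congr 2
  funext i
  fin_cases i <;> simp

/-! ## §1 The self-dual locus of `(id, J)` and the transitivity of `SL₂(F)` on each type, on the root star and on flags -/

omit [IsDiscreteValuationRing 𝒪[F]] in
/-- **THE SELF-DUAL LOCUS OF THE ALTERNATING PLANE IS `SL₂(F)·GL₂(𝒪)`**: if `ᵗh J h = det h · J` is the matrix of an element of `GL₂(𝒪)` (i.e. `|det h| = 1`), then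
`h = u·k` with `u = h·diag(1, det h)⁻¹ ∈ SL₂(F)` and `k = diag(1, det h) ∈ GL₂(𝒪)` — the hypothesis `hsd` of ★ `forall_isSelfDualLattice_exists_latt_eq_of_selfDualLocus`.
[cite: Serre1980Trees, Ch. II §1.2] -/
theorem selfDualLocus_id_altJ (h : GL (Fin 2) F)
    (hh : ∃ J' ∈ glInt 2 F, (J' : Matrix (Fin 2) (Fin 2) F) = formCongr (RingHom.id F) h !![(0 : F), 1; -1, 0]) :
    ∃ u ∈ unitaryGroupOfForm (RingHom.id F) !![(0 : F), 1; -1, 0], ∃ k ∈ glInt 2 F, h = u * k := by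
  have hdet : valuation F (h : Matrix (Fin 2) (Fin 2) F).det = 1 := by
    have hu : IsUnimodular₂ (formCongr (RingHom.id F) h !![(0 : F), 1; -1, 0]) := (isUnimodular₂_iff_exists_mem_glInt _).2 hh
    rw [formCongr_id_altJ] at hu
    exact (isUnimodular₂_smul_altJ_iff _).1 hu
  have hdet0 : (h : Matrix (Fin 2) (Fin 2) F).det ≠ 0 := (h.isUnit.map Matrix.detMonoidHom).ne_zero
  obtain ⟨k, hkval, hkK, hkdet⟩ := exists_mem_glInt_coe_eq_diagonal hdet
  refine ⟨h * k⁻¹, (mem_unitaryGroupOfForm_id_altJ_iff _).2 ?_, k, hkK, by rw [inv_mul_cancel_right]⟩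
  rw [← Matrix.GeneralLinearGroup.val_det_apply, map_mul, map_inv, Units.val_mul, Units.val_inv_eq_inv_val,
    Matrix.GeneralLinearGroup.val_det_apply, Matrix.GeneralLinearGroup.val_det_apply, hkdet, mul_inv_cancel₀ hdet0]

omit [IsDiscreteValuationRing 𝒪[F]] in
/-- **(hA) `SL₂(F)` IS TRANSITIVE ON SELF-DUAL VERTICES** (`|det| = 1` lattices): every such `M` is `latt ↑u`, `u ∈ SL₂(F)` (★ F0P2-p02's
`forall_isSelfDualLattice_exists_latt_eq_of_selfDualLocus` over `selfDualLocus_id_altJ`). [cite: Serre1980Trees, Ch. II §1.2–§1.4] -/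
theorem forall_isSelfDualLattice_exists_latt_eq_id_altJ :
    ∀ M : Submodule 𝒪[F] (Fin 2 → F), IsSelfDualLattice (RingHom.id F) !![(0 : F), 1; -1, 0] M →
      ∃ u : ↥(unitaryGroupOfForm (RingHom.id F) !![(0 : F), 1; -1, 0]), latt ((u : GL (Fin 2) F) : Matrix (Fin 2) (Fin 2) F) = M :=
  forall_isSelfDualLattice_exists_latt_eq_of_selfDualLocus (RingHom.id F) _ selfDualLocus_id_altJ

omit [IsDiscreteValuationRing 𝒪[F]] in
/-- **(hB) `SL₂(F)` IS TRANSITIVE ON `ϖ`-MODULAR VERTICES** through any reference element `g₁` with `det g₁ = ϖ`: every `ϖ`-modular `M` is `latt ↑(u·g₁)`, `u ∈ SL₂(F)`.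
[cite: Serre1980Trees, Ch. II §1.2–§1.4] -/
theorem forall_isModularLattice_exists_latt_mul_eq_id_altJ (h0 : ϖ ≠ 0) (g₁ : GL (Fin 2) F) (hg₁ : (g₁ : Matrix (Fin 2) (Fin 2) F).det = ϖ) :
    ∀ M : Submodule 𝒪[F] (Fin 2 → F), IsModularLattice (RingHom.id F) ϖ !![(0 : F), 1; -1, 0] M →
      ∃ u : ↥(unitaryGroupOfForm (RingHom.id F) !![(0 : F), 1; -1, 0]),
        latt (((u : GL (Fin 2) F) * g₁ : GL (Fin 2) F) : Matrix (Fin 2) (Fin 2) F) = M :=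
  forall_isModularLattice_exists_latt_mul_eq_of_selfDualLocus (RingHom.id F) _ h0 g₁ (by rw [formCongr_id_altJ, hg₁]) selfDualLocus_id_altJ

include hϖ in
/-- **THE ROOT STAR: `SL₂(𝒪)` IS TRANSITIVE ON THE NEIGHBOURS OF THE ROOT.**  Every `ϖ`-modular `N` with `ϖ𝒪² ≤ N ≤ 𝒪²` is `latt ↑(k·g₁)` for `↑g₁ = diag(1, ϖ)` and some
`k ∈ SL₂(F) ∩ GL₂(𝒪)` (★ B-p04's normal form `N = latt (P·diag(1,ϖ))`, `P ∈ GL₂(𝒪)`, with `k := P·diag(1, (det P)⁻¹)`).  This is the binder `hK` of ★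
`forall_flag_exists_latt_eq_of_rootStar` for `(id, J)`. [cite: Serre1980Trees, Ch. II §1.1 and §1.4] -/
theorem forall_isModularLattice_rootStar_exists_latt_mul_eq_id_altJ (g₁ : GL (Fin 2) F) (hg₁ : (g₁ : Matrix (Fin 2) (Fin 2) F) = Matrix.diagonal ![1, ϖ]) :
    ∀ N : Submodule 𝒪[F] (Fin 2 → F), IsModularLattice (RingHom.id F) ϖ !![(0 : F), 1; -1, 0] N →
      scaleLattice ϖ (latt (1 : Matrix (Fin 2) (Fin 2) F)) ≤ N → N ≤ latt (1 : Matrix (Fin 2) (Fin 2) F) →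
      ∃ k : ↥(unitaryGroupOfForm (RingHom.id F) !![(0 : F), 1; -1, 0]), (k : GL (Fin 2) F) ∈ glInt 2 F ∧
        latt (((k : GL (Fin 2) F) * g₁ : GL (Fin 2) F) : Matrix (Fin 2) (Fin 2) F) = N := by
  intro N hN h1 h2
  obtain ⟨P, hP, hNP, -⟩ :=
    exists_eq_latt_mul_diagonal_of_isModularLattice (RingHom.id F) (fun _ => rfl) hϖ isUnimodular₂_altJ hN h1 h2
  have hPdet : valuation F (P : Matrix (Fin 2) (Fin 2) F).det = 1 := valuation_det_eq_one_of_mem_glInt hP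
  have hPdet0 : (P : Matrix (Fin 2) (Fin 2) F).det ≠ 0 := (P.isUnit.map Matrix.detMonoidHom).ne_zero
  have hinv : valuation F ((P : Matrix (Fin 2) (Fin 2) F).det)⁻¹ = 1 := by rw [map_inv₀, hPdet, inv_one]
  obtain ⟨D, hDval, hDK, hDdet⟩ := exists_mem_glInt_coe_eq_diagonal hinv
  have hkdet : (((P * D : GL (Fin 2) F)) : Matrix (Fin 2) (Fin 2) F).det = 1 := by
    rw [Units.val_mul, det_mul, hDdet, mul_inv_cancel₀ hPdet0]
  refine ⟨⟨P * D, (mem_unitaryGroupOfForm_id_altJ_iff _).2 hkdet⟩, Subgroup.mul_mem _ hP hDK, ?_⟩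
  -- `latt ((P D) g₁) = latt (P g₁ D) = latt (P g₁) = latt (P · diag(ϖ⁰, ϖ¹)) = N`
  have hcomm : D * g₁ = g₁ * D := by
    ext : 1
    rw [Units.val_mul, Units.val_mul, hDval, hg₁, diagonal_mul_diagonal, diagonal_mul_diagonal]
    congr 1
    funext i
    fin_cases i <;> simp [mul_comm]
  have hdiag : Matrix.diagonal ![(1 : F), ϖ] = Matrix.diagonal ![ϖ ^ (0 : ℤ), ϖ ^ (1 : ℤ)] := by
    congr 1
    funext i
    fin_cases i <;> simp
  rw [show (((⟨P * D, (mem_unitaryGroupOfForm_id_altJ_iff _).2 hkdet⟩ : ↥(unitaryGroupOfForm (RingHom.id F) !![(0 : F), 1; -1, 0])) :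
      GL (Fin 2) F)) = P * D from rfl, mul_assoc, hcomm, ← mul_assoc, latt_mul_of_mem_glInt _ _ hDK, hNP, Units.val_mul, hg₁, hdiag]

include hϖ in
/-- **(hI) `SL₂(F)` IS TRANSITIVE ON FLAGS** `(M self-dual, N ϖ-modular, ϖM ≤ N ≤ M)`: `(M, N) = (latt ↑u, latt ↑(u·g₁))` with `u ∈ SL₂(F)`, `↑g₁ = diag(1, ϖ)`
(★ B-p04's `forall_flag_exists_latt_eq_of_rootStar` over (hA) and the root star). [cite: Serre1980Trees, Ch. II §1.4] [cite: BruhatTits1972, §10] -/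
theorem forall_flag_exists_latt_eq_id_altJ (g₁ : GL (Fin 2) F) (hg₁ : (g₁ : Matrix (Fin 2) (Fin 2) F) = Matrix.diagonal ![1, ϖ]) :
    ∀ M N : Submodule 𝒪[F] (Fin 2 → F), IsSelfDualLattice (RingHom.id F) !![(0 : F), 1; -1, 0] M →
      IsModularLattice (RingHom.id F) ϖ !![(0 : F), 1; -1, 0] N → scaleLattice ϖ M ≤ N → N ≤ M →
      ∃ u : ↥(unitaryGroupOfForm (RingHom.id F) !![(0 : F), 1; -1, 0]),
        latt ((u : GL (Fin 2) F) : Matrix (Fin 2) (Fin 2) F) = M ∧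
          latt (((u : GL (Fin 2) F) * g₁ : GL (Fin 2) F) : Matrix (Fin 2) (Fin 2) F) = N :=
  forall_flag_exists_latt_eq_of_rootStar (RingHom.id F) ϖ !![(0 : F), 1; -1, 0] g₁ forall_isSelfDualLattice_exists_latt_eq_id_altJ
    (forall_isModularLattice_rootStar_exists_latt_mul_eq_id_altJ hϖ g₁ hg₁)

/-! ## §2 One vertex orbit and one dart orbit of `GL₂(F)`, with prescribed determinant -/

omit [IsDiscreteValuationRing 𝒪[F]] in
include hϖ in
/-- **THE REFERENCE EDGE**: the root `v₀ = 𝒪²` and `v₁ = 𝒪 ⊕ ϖ𝒪 = latt diag(1, ϖ)` are adjacent. [cite: Serre1980Trees, Ch. II §1.1] -/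
theorem latticeTree_adj_root
    (v₀ v₁ : {M : Submodule 𝒪[F] (Fin 2 → F) // IsSpecialLattice (RingHom.id F) ϖ !![(0 : F), 1; -1, 0] M})
    (hv₀ : v₀.1 = latt (1 : Matrix (Fin 2) (Fin 2) F)) (hv₁ : v₁.1 = latt (Matrix.diagonal ![1, ϖ])) :
    (latticeTree (RingHom.id F) ϖ !![(0 : F), 1; -1, 0]).Adj v₀ v₁ := by
  have h0 := hϖ.ne_zero
  obtain ⟨g₁, hg₁, hdet₁⟩ := exists_coe_eq_diagonal_one_uniformizer (F := F) h0
  have hsd : IsSelfDualLattice (RingHom.id F) !![(0 : F), 1; -1, 0] v₀.1 := by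
    rw [hv₀]
    exact (isSelfDualLattice_id_altJ_iff _).2 ⟨1, by rw [Units.val_one], by rw [Units.val_one, det_one, map_one]⟩
  have hmod : IsModularLattice (RingHom.id F) ϖ !![(0 : F), 1; -1, 0] v₁.1 := by
    rw [hv₁]
    exact (isModularLattice_id_altJ_iff h0 _).2 ⟨g₁, by rw [hg₁], by rw [hdet₁]⟩
  rw [latticeTree_adj_iff]
  refine ⟨fun heq => not_isModularLattice_of_isSelfDualLattice (RingHom.id F) (fun _ => rfl) hϖ _ hsd (heq ▸ hmod), Or.inl ⟨hsd, hmod, ?_, ?_⟩⟩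
  · -- `ϖ𝒪² = latt (1·diag(ϖ¹, ϖ¹)) ≤ latt (1·diag(ϖ⁰, ϖ¹)) = v₁`
    rw [hv₀, hv₁, show scaleLattice (E := F) ϖ = scaleLattice (ϖ ^ (1 : ℤ)) by rw [zpow_one],
      latt_one_eq_latt_mul_diagonal_zero (ϖ := ϖ) 1 (one_mem _), scaleLattice_zpow_latt_mul_diagonal hϖ, latt_diagonal_one_uniformizer_eq (F := F),
      latt_mul_diagonal_le_iff hϖ]
    norm_num
  · -- `v₁ = latt (1·diag(ϖ⁰, ϖ¹)) ≤ latt (1·diag(ϖ⁰, ϖ⁰)) = 𝒪²`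
    rw [hv₀, hv₁, latt_diagonal_one_uniformizer_eq (F := F), latt_one_eq_latt_mul_diagonal_zero (ϖ := ϖ) 1 (one_mem _),
      latt_mul_diagonal_le_iff hϖ]
    norm_num

include hϖ in
/-- **`SL₂(F)` MOVES THE ROOT TO EVERY SELF-DUAL VERTEX**: `N = g · v₀` with `det g = 1`. [cite: Serre1980Trees, Ch. II §1.2–§1.4] -/
theorem exists_det_eq_one_and_glVertexAct_eq
    (v₀ : {M : Submodule 𝒪[F] (Fin 2 → F) // IsSpecialLattice (RingHom.id F) ϖ !![(0 : F), 1; -1, 0] M})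
    (hv₀ : v₀.1 = latt (1 : Matrix (Fin 2) (Fin 2) F))
    (N : {M : Submodule 𝒪[F] (Fin 2 → F) // IsSpecialLattice (RingHom.id F) ϖ !![(0 : F), 1; -1, 0] M})
    (hN : IsSelfDualLattice (RingHom.id F) !![(0 : F), 1; -1, 0] N.1) :
    ∃ g : GL (Fin 2) F, (g : Matrix (Fin 2) (Fin 2) F).det = 1 ∧ glVertexAct hϖ g v₀ = N := by
  obtain ⟨u, hu⟩ := forall_isSelfDualLattice_exists_latt_eq_id_altJ N.1 hN
  refine ⟨u, (mem_unitaryGroupOfForm_id_altJ_iff _).1 u.2, (glVertexAct_eq_iff hϖ _ _ _).2 ⟨0, ?_⟩⟩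
  rw [zpow_zero, scaleLattice_one, hv₀, mapGL_latt_one, hu]

include hϖ in
/-- **… AND TO EVERY `ϖ`-MODULAR VERTEX WITH ANY PRESCRIBED DETERMINANT OF VALUATION `|ϖ|`**: `N = g · v₀` with `det g = c` (`g = u·diag(1,ϖ)·diag(1, c∕ϖ)`,
`u ∈ SL₂(F)`). [cite: Serre1980Trees, Ch. II §1.2–§1.4] -/
theorem exists_det_eq_and_glVertexAct_eq
    (v₀ : {M : Submodule 𝒪[F] (Fin 2 → F) // IsSpecialLattice (RingHom.id F) ϖ !![(0 : F), 1; -1, 0] M})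
    (hv₀ : v₀.1 = latt (1 : Matrix (Fin 2) (Fin 2) F))
    (N : {M : Submodule 𝒪[F] (Fin 2 → F) // IsSpecialLattice (RingHom.id F) ϖ !![(0 : F), 1; -1, 0] M})
    (hN : IsModularLattice (RingHom.id F) ϖ !![(0 : F), 1; -1, 0] N.1) {c : F} (hc : valuation F c = valuation F ϖ) :
    ∃ g : GL (Fin 2) F, (g : Matrix (Fin 2) (Fin 2) F).det = c ∧ glVertexAct hϖ g v₀ = N := by
  have h0 := hϖ.ne_zero
  have hv0 : valuation F ϖ ≠ 0 := (Valuation.ne_zero_iff _).2 h0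
  obtain ⟨g₁, -, hdet₁⟩ := exists_coe_eq_diagonal_one_uniformizer (F := F) h0
  obtain ⟨u, hu⟩ := forall_isModularLattice_exists_latt_mul_eq_id_altJ h0 g₁ hdet₁ N.1 hN
  have hcu : valuation F (c / ϖ) = 1 := by rw [map_div₀, hc, div_self hv0]
  obtain ⟨D, -, hDK, hDdet⟩ := exists_mem_glInt_coe_eq_diagonal hcu
  refine ⟨(u : GL (Fin 2) F) * g₁ * D, ?_, (glVertexAct_eq_iff hϖ _ _ _).2 ⟨0, ?_⟩⟩
  · rw [Units.val_mul, Units.val_mul, det_mul, det_mul, (mem_unitaryGroupOfForm_id_altJ_iff _).1 u.2, hdet₁, hDdet, one_mul, mul_div_cancel₀ c h0]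
  · rw [zpow_zero, scaleLattice_one, hv₀, mapGL_latt_one, latt_mul_of_mem_glInt _ _ hDK, hu]

include hϖ in
/-- **`SL₂(F)` MOVES THE REFERENCE DART TO EVERY DART WITH SELF-DUAL SOURCE**: for `a ∼ b` with `a` self-dual, `(a, b) = g · (v₀, v₁)` with `det g = 1`
(flag transitivity `forall_flag_exists_latt_eq_id_altJ`). [cite: Serre1980Trees, Ch. II §1.4] -/
theorem exists_det_eq_one_and_glVertexAct_eq_of_adj
    (v₀ v₁ : {M : Submodule 𝒪[F] (Fin 2 → F) // IsSpecialLattice (RingHom.id F) ϖ !![(0 : F), 1; -1, 0] M})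
    (hv₀ : v₀.1 = latt (1 : Matrix (Fin 2) (Fin 2) F)) (hv₁ : v₁.1 = latt (Matrix.diagonal ![1, ϖ]))
    {a b : {M : Submodule 𝒪[F] (Fin 2 → F) // IsSpecialLattice (RingHom.id F) ϖ !![(0 : F), 1; -1, 0] M}}
    (hab : (latticeTree (RingHom.id F) ϖ !![(0 : F), 1; -1, 0]).Adj a b) (ha : IsSelfDualLattice (RingHom.id F) !![(0 : F), 1; -1, 0] a.1) :
    ∃ g : GL (Fin 2) F, (g : Matrix (Fin 2) (Fin 2) F).det = 1 ∧ glVertexAct hϖ g v₀ = a ∧ glVertexAct hϖ g v₁ = b := by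
  have h0 := hϖ.ne_zero
  obtain ⟨g₁, hg₁, -⟩ := exists_coe_eq_diagonal_one_uniformizer (F := F) h0
  obtain ⟨-, hcases⟩ := (latticeTree_adj_iff _ _ _ _ _).1 hab
  have hb : IsModularLattice (RingHom.id F) ϖ !![(0 : F), 1; -1, 0] b.1 ∧ scaleLattice ϖ a.1 ≤ b.1 ∧ b.1 ≤ a.1 := by
    rcases hcases with ⟨-, hb, h1, h2⟩ | ⟨-, ha', -, -⟩
    · exact ⟨hb, h1, h2⟩
    · exact (not_isModularLattice_of_isSelfDualLattice (RingHom.id F) (fun _ => rfl) hϖ _ ha ha').elim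
  obtain ⟨u, hua, hub⟩ := forall_flag_exists_latt_eq_id_altJ hϖ g₁ hg₁ a.1 b.1 ha hb.1 hb.2.1 hb.2.2
  refine ⟨u, (mem_unitaryGroupOfForm_id_altJ_iff _).1 u.2, (glVertexAct_eq_iff hϖ _ _ _).2 ⟨0, ?_⟩, (glVertexAct_eq_iff hϖ _ _ _).2 ⟨0, ?_⟩⟩
  · rw [zpow_zero, scaleLattice_one, hv₀, mapGL_latt_one, hua]
  · rw [zpow_zero, scaleLattice_one, hv₁, ← hg₁, mapGL_latt, hub]

include hϖ in
/-- **THE SWAP** `w = (0 −1; c 0)` (`|c| = |ϖ|`): `det w = c`, `w · v₀ = v₁` (`w = diag(1,ϖ)·k₀`, `k₀ = (0 −1; c∕ϖ 0) ∈ GL₂(𝒪)`) and `w · v₁ = v₀`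
(`w·diag(1,ϖ) = ϖ·k₀`) — an INVERSION of the reference edge. [cite: Serre1980Trees, Ch. II §1.2–§1.3] -/
theorem exists_det_eq_and_glVertexAct_swap
    (v₀ v₁ : {M : Submodule 𝒪[F] (Fin 2 → F) // IsSpecialLattice (RingHom.id F) ϖ !![(0 : F), 1; -1, 0] M})
    (hv₀ : v₀.1 = latt (1 : Matrix (Fin 2) (Fin 2) F)) (hv₁ : v₁.1 = latt (Matrix.diagonal ![1, ϖ])) {c : F} (hc : valuation F c = valuation F ϖ) :
    ∃ w : GL (Fin 2) F, (w : Matrix (Fin 2) (Fin 2) F).det = c ∧ glVertexAct hϖ w v₀ = v₁ ∧ glVertexAct hϖ w v₁ = v₀ := by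
  have h0 := hϖ.ne_zero
  have hv0 : valuation F ϖ ≠ 0 := (Valuation.ne_zero_iff _).2 h0
  have hc0 : c ≠ 0 := fun h => hv0 (by rw [← hc, h, map_zero])
  have hcu : valuation F (c / ϖ) = 1 := by rw [map_div₀, hc, div_self hv0]
  obtain ⟨g₁, hg₁, -⟩ := exists_coe_eq_diagonal_one_uniformizer (F := F) h0
  -- `k₀ = (0 −1; c∕ϖ 0) ∈ GL₂(𝒪)`
  have hk₀det : (!![(0 : F), -1; c / ϖ, 0]).det = c / ϖ := by rw [det_fin_two_of]; ring
  set k₀ : GL (Fin 2) F := Matrix.GeneralLinearGroup.mk'' _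
    (isUnit_iff_ne_zero.2 (hk₀det.symm ▸ div_ne_zero hc0 h0 : (!![(0 : F), -1; c / ϖ, 0]).det ≠ 0)) with hk₀
  have hk₀val : (k₀ : Matrix (Fin 2) (Fin 2) F) = !![(0 : F), -1; c / ϖ, 0] := rfl
  have hk₀K : k₀ ∈ glInt 2 F := by
    refine mem_glInt_of_isIntegralMatrix (fun i j => ?_) (by rw [hk₀val, hk₀det, hcu])
    rw [hk₀val]
    fin_cases i <;> fin_cases j <;> first | (simp [Valuation.mem_integer_iff]; done) | simpa [Valuation.mem_integer_iff] using hcu.le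
  -- `w = (0 −1; c 0)`
  have hwdet : (!![(0 : F), -1; c, 0]).det = c := by rw [det_fin_two_of]; ring
  set w : GL (Fin 2) F := Matrix.GeneralLinearGroup.mk'' _ (isUnit_iff_ne_zero.2 (hwdet.symm ▸ hc0 : (!![(0 : F), -1; c, 0]).det ≠ 0)) with hw
  have hwval : (w : Matrix (Fin 2) (Fin 2) F) = !![(0 : F), -1; c, 0] := rfl
  have h1 : w = g₁ * k₀ := by
    ext : 1
    rw [Units.val_mul, hwval, hg₁, hk₀val]
    ext i j
    fin_cases i <;> fin_cases j <;> simp [Matrix.mul_apply, Fin.sum_univ_two, mul_div_cancel₀ c h0]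
  have h2 : (((w * g₁ : GL (Fin 2) F)) : Matrix (Fin 2) (Fin 2) F) = ϖ • (k₀ : Matrix (Fin 2) (Fin 2) F) := by
    rw [Units.val_mul, hwval, hg₁, hk₀val]
    ext i j
    fin_cases i <;> fin_cases j <;> simp [Matrix.mul_apply, Fin.sum_univ_two, mul_div_cancel₀ c h0, mul_comm]
  have hlatt₀ : latt ((k₀ : Matrix (Fin 2) (Fin 2) F)) = latt (1 : Matrix (Fin 2) (Fin 2) F) := by
    have h := latt_mul_of_mem_glInt 1 k₀ hk₀K
    rwa [one_mul, Units.val_one] at h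
  refine ⟨w, hwdet, (glVertexAct_eq_iff hϖ _ _ _).2 ⟨0, ?_⟩, (glVertexAct_eq_iff hϖ _ _ _).2 ⟨-1, ?_⟩⟩
  · rw [zpow_zero, scaleLattice_one, hv₀, mapGL_latt_one, h1, latt_mul_of_mem_glInt _ _ hk₀K, hg₁, hv₁]
  · rw [_root_.zpow_neg, zpow_one, hv₁, ← hg₁, mapGL_latt, h2, ← scaleLattice_latt, scaleLattice_scaleLattice, inv_mul_cancel₀ h0,
      scaleLattice_one, hlatt₀, hv₀]

include hϖ in
/-- **DARTS WITH `ϖ`-MODULAR SOURCE**: for `a ∼ b` with `a` modular and any `|c| = |ϖ|`, `(a, b) = g · (v₀, v₁)` with `det g = c` (`g = u·w`: move `(b, a)` by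
`SL₂(F)`, then swap). [cite: Serre1980Trees, Ch. II §1.2–§1.4] -/
theorem exists_det_eq_and_glVertexAct_eq_of_adj
    (v₀ v₁ : {M : Submodule 𝒪[F] (Fin 2 → F) // IsSpecialLattice (RingHom.id F) ϖ !![(0 : F), 1; -1, 0] M})
    (hv₀ : v₀.1 = latt (1 : Matrix (Fin 2) (Fin 2) F)) (hv₁ : v₁.1 = latt (Matrix.diagonal ![1, ϖ]))
    {a b : {M : Submodule 𝒪[F] (Fin 2 → F) // IsSpecialLattice (RingHom.id F) ϖ !![(0 : F), 1; -1, 0] M}}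
    (hab : (latticeTree (RingHom.id F) ϖ !![(0 : F), 1; -1, 0]).Adj a b) (ha : IsModularLattice (RingHom.id F) ϖ !![(0 : F), 1; -1, 0] a.1)
    {c : F} (hc : valuation F c = valuation F ϖ) :
    ∃ g : GL (Fin 2) F, (g : Matrix (Fin 2) (Fin 2) F).det = c ∧ glVertexAct hϖ g v₀ = a ∧ glVertexAct hϖ g v₁ = b := by
  obtain ⟨-, hcases⟩ := (latticeTree_adj_iff _ _ _ _ _).1 hab
  have hb : IsSelfDualLattice (RingHom.id F) !![(0 : F), 1; -1, 0] b.1 := by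
    rcases hcases with ⟨ha', -, -, -⟩ | ⟨hb, -, -, -⟩
    · exact (not_isModularLattice_of_isSelfDualLattice (RingHom.id F) (fun _ => rfl) hϖ _ ha' ha).elim
    · exact hb
  obtain ⟨u, hu1, hub, hua⟩ := exists_det_eq_one_and_glVertexAct_eq_of_adj hϖ v₀ v₁ hv₀ hv₁ hab.symm hb
  obtain ⟨w, hwc, hw₀, hw₁⟩ := exists_det_eq_and_glVertexAct_swap hϖ v₀ v₁ hv₀ hv₁ hc
  refine ⟨u * w, by rw [Units.val_mul, det_mul, hu1, hwc, one_mul], ?_, ?_⟩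
  · rw [glVertexAct_mul, hw₀, hua]
  · rw [glVertexAct_mul, hw₁, hub]

include hϖ in
/-- **ONE VERTEX ORBIT**: `GL₂(F)` is transitive on the vertices of the tree of `SL₂(F)`. [cite: Serre1980Trees, Ch. II §1.2–§1.3] -/
theorem exists_glVertexAct_eq
    (v₀ : {M : Submodule 𝒪[F] (Fin 2 → F) // IsSpecialLattice (RingHom.id F) ϖ !![(0 : F), 1; -1, 0] M})
    (hv₀ : v₀.1 = latt (1 : Matrix (Fin 2) (Fin 2) F))
    (N : {M : Submodule 𝒪[F] (Fin 2 → F) // IsSpecialLattice (RingHom.id F) ϖ !![(0 : F), 1; -1, 0] M}) :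
    ∃ g : GL (Fin 2) F, glVertexAct hϖ g v₀ = N := by
  rcases N.2 with hN | hN
  · obtain ⟨g, -, hg⟩ := exists_det_eq_one_and_glVertexAct_eq hϖ v₀ hv₀ N hN
    exact ⟨g, hg⟩
  · obtain ⟨g, -, hg⟩ := exists_det_eq_and_glVertexAct_eq hϖ v₀ hv₀ N hN (c := ϖ) rfl
    exact ⟨g, hg⟩

include hϖ in
/-- **ONE DART ORBIT**: `GL₂(F)` is transitive on the darts (ordered edges) of the tree of `SL₂(F)` — edges AND inversions. [cite: Serre1980Trees, Ch. II §1.2–§1.3] -/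
theorem exists_glVertexAct_eq_of_adj
    (v₀ v₁ : {M : Submodule 𝒪[F] (Fin 2 → F) // IsSpecialLattice (RingHom.id F) ϖ !![(0 : F), 1; -1, 0] M})
    (hv₀ : v₀.1 = latt (1 : Matrix (Fin 2) (Fin 2) F)) (hv₁ : v₁.1 = latt (Matrix.diagonal ![1, ϖ]))
    {a b : {M : Submodule 𝒪[F] (Fin 2 → F) // IsSpecialLattice (RingHom.id F) ϖ !![(0 : F), 1; -1, 0] M}}
    (hab : (latticeTree (RingHom.id F) ϖ !![(0 : F), 1; -1, 0]).Adj a b) :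
    ∃ g : GL (Fin 2) F, glVertexAct hϖ g v₀ = a ∧ glVertexAct hϖ g v₁ = b := by
  rcases a.2 with ha | ha
  · obtain ⟨g, -, hg⟩ := exists_det_eq_one_and_glVertexAct_eq_of_adj hϖ v₀ v₁ hv₀ hv₁ hab ha
    exact ⟨g, hg⟩
  · obtain ⟨g, -, hg⟩ := exists_det_eq_and_glVertexAct_eq_of_adj hϖ v₀ v₁ hv₀ hv₁ hab ha (c := ϖ) rfl
    exact ⟨g, hg⟩

end Literature.NumberTheory.Automorphic.HermitianLatticeTree

end
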